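import Summits.BirchSwinnertonDyer.BirchSwinnertonDyer.Theorems.EisensteinPrimesMazurMCOnX1RankZeroDeepWitness
import Literature.NumberTheory.EllipticCurves.Rank1Residual.X1ThreeDescentCertificate
import Literature.NumberTheory.EllipticCurves.Rank1Residual.X1RankZeroCertificate
import Mathlib.NumberTheory.MulChar.Basic
import HarnessLib

/-!
# Crux idea g12 — CUBIC RÉDEI RECIPROCITY at the étale end (bsd-eis-idea g12; crux
`stmt-BirchSwinnertonDyer-19035`, decl
`Summit.BirchSwinnertonDyer.BirchSwinnertonDyer.Theses.EisensteinPrimes.MazurMCOnX1RankZero`)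

STRATUM. `p = 3`, θ = 1, semistable: `W = E_ét` is the member of a Mazur class carrying the rational
point `P` of order `3` (`#E(ℚ)_tors = 3`), `W' = E_μ = E_ét/⟨P⟩` its `3`-neighbour (`#E_μ(ℚ)_tors = 1`),
`N` squarefree, `3 ∤ N` (`a₃ ≡ 1 (mod 3)` is then automatic: an X1 pair of type A). Every bad prime `ℓ` is
of exactly one of three DECIDABLE kinds, read off the two minimal discriminants:
* TAMAGAWA primes `Tam`: `v_ℓ(Δ_ét) = 3·v_ℓ(Δ_μ)` (`P ∉ E⁰(ℚ_ℓ)`; split multiplicative is forced;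
  `c_ℓ(E_ét) = 3·c_ℓ(E_μ)`);
* KUMMER primes `S⁺`: `v_ℓ(Δ_μ) = 3·v_ℓ(Δ_ét)` and `ℓ ≡ 1 (mod 3)` (`P ∈ E⁰(ℚ_ℓ)`, split, `μ₃ ⊂ ℚ_ℓ^×`;
  `c_ℓ(E_μ) = 3·c_ℓ(E_ét)`);
* INERT primes: `v_ℓ(Δ_μ) = 3·v_ℓ(Δ_ét)` and `ℓ ≡ 2 (mod 3)` (non-split; no Tamagawa change).
(NB: `3 ∣ v_ℓ(Δ_ét)` alone does NOT detect `Tam`: 81 of the 1997 split Kummer-type primes `N < 1.3·10⁵`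
have `3 ∣ v_ℓ(Δ_ét)`; hence the two-curve typing.) The CUBIC RÉDEI MATRIX is
`M = (χ_ℓ(ℓ₀))_{ℓ₀ ∈ Tam, ℓ ∈ S⁺} ∈ 𝔽₃^{Tam × S⁺}` (`χ_ℓ` a cubic character mod `ℓ`);
`t := #Tam − #S⁺` (odd at analytic rank `0`; `= v₃(∏c(E_ét)/∏c(E_μ))`) and
`s := #S⁺ − rank M = dim_{𝔽₃} Sel^{φ}(E_ét/ℚ)` (class field theory; `φ : E_ét → E_μ` the étale isogeny).

THEOREM SIDE (first `3`-isogeny descent, Cassels 1965; typed below as SUPPORT `FirstDescent*`, to be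
proved): `(t,s) = (1,0)` ⟹ `Ш(E_ét)[3] = Ш(E_μ)[3] = 0`; `t ≤ −1` or `s ≥ 1` ⟹ `Ш(E_ét)[3] ≠ 0`;
`t ≥ 3` ⟹ `dim Ш(E_μ)[3] ≥ 2`. CONJECTURE SIDE (the lever, `CubicRedeiReciprocity`): `(t,s) = (1,0)` ⟹
`3 ∤ #Ш_an(E_ét)`, i.e. `v₃(L(E_ét,1)/Ω_ét) = v₃(∏_ℓ c_ℓ(E_ét)) − 2` — an explicit reciprocity law between
cubic residue symbols among the bad primes and the `3`-adic valuation of the central `L`-value, with NO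
Selmer group and NO Iwasawa module in its statement. Census (Cremona, `N < 5·10⁵`; every semistable
rank-0 class with `3 ∤ N`, one member of torsion order `3` and a torsion-free `3`-neighbour): twin classes
3890, law 3890/0 — deep (`9 ∣ #Ш_an` at a member) ⟺ `(t,s) ≠ (1,0)` EXACTLY (385: `(t,s,v_ét,v_μ)` =
`(−1,2,2,0)` ×104, `(1,1,2,2)` ×45, `(3,0,0,2)` ×234, `(3,0,2,4)` ×2 = `58646f`, `376402f`), shallow
3505 = `(1,0)` (lonely sub-case `#Tam = 1, S⁺ = ∅`: 1530); 9-isogeny classes: 137/137 more `(1,0)` pairs.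

Typed here (all `def … : Prop`, no axiom, no sorry): the decidable data `tamPrimes`, `kumPrimes`,
`tamExcess` (`t`), `RedeiNondegenerate` (`s = 0`, character form), `redeiDim` (`s`), `IsThreeTwin`;
the candidate `CubicRedeiReciprocity` (K1) and its symbol-free lonely case (K1₀); the support statements
`FirstDescentTrivial` (K2), `FirstDescentDeepEtale` / `FirstDescentDeepMu` (K3); the empirical uniform
first-layer cap `EtaleFirstLayerCap` (K4, refutable); and PROVED compositions: K1 ⟹ the crux's
conclusion `MazurMainConjecture E_ét 3` at every pair of the shallow stratum
(`mazurMainConjecture_of_cubicRedeiReciprocity`, via `Rank1ResidualX1Converse.mazurMainConjecture_of_shaAn_unit`);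
K1 + the crux off the stratum ⟹ the crux BY NAME (`mazurMCOnX1RankZero_of_cubicRedeiReciprocity_of_offStratum`);
K3a + a depth-2 cap ⟹ `BSD(E_ét,3)` through the cell's door `X1.bsdp_of_casselsTate_of_exists_torsion`.
-/

set_option linter.dupNamespace false
set_option autoImplicit false

noncomputable section

open scoped Classical
open WeierstrassCurve Literature.NumberTheory.EllipticCurves
  Literature.NumberTheory.EllipticCurves.Rank1Residual
  Literature.NumberTheory.EllipticCurves.Greenberg1999
  Summit.BirchSwinnertonDyer.BirchSwinnertonDyer.Theorems.Rank1ResidualX1Defs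
  Summit.BirchSwinnertonDyer.BirchSwinnertonDyer.Theorems.Rank1ResidualX1Converse

namespace Summit.BirchSwinnertonDyer.BirchSwinnertonDyer.Cruxes.MazurMCOnX1RankZero.CubicRedei

/-! ## §0. Decidable data of the twin `(E_ét, E_μ)` (read off the two minimal discriminants) -/

section Data

variable (W W' : WeierstrassCurve ℚ) [W.IsGloballyMinimal] [W'.IsGloballyMinimal]

/-- `v_ℓ(Δ_min)`. -/
def vDisc (W : WeierstrassCurve ℚ) [W.IsGloballyMinimal] (ℓ : ℕ) : ℕ :=
  padicValInt ℓ W.minimalDiscriminantInt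

/-- Bad primes of a globally minimal model: the prime support of `Δ_min`. -/
def badPrimes (W : WeierstrassCurve ℚ) [W.IsGloballyMinimal] : Finset ℕ :=
  W.minimalDiscriminantInt.natAbs.primeFactors

/-- `(W, W') = (E_ét, E_μ)` is a θ = 1 TWIN at `3`: `ℚ`-isogenous, `#W(ℚ)_tors = 3`, `#W'(ℚ)_tors = 1`, and
at every bad prime the minimal discriminants are in ratio `3` or `1/3` (`W' = W/⟨P⟩` along the
`3`-isogeny with kernel the rational `3`-torsion: Tate-curve bookkeeping). -/
def IsThreeTwin : Prop :=
  IsIsogenous W W' ∧ W.torsionOrder = 3 ∧ W'.torsionOrder = 1 ∧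
    ∀ ℓ ∈ badPrimes W, vDisc W ℓ = 3 * vDisc W' ℓ ∨ vDisc W' ℓ = 3 * vDisc W ℓ

/-- TAMAGAWA primes: `v_ℓ(Δ_ét) = 3·v_ℓ(Δ_μ)` (`P ∉ E⁰(ℚ_ℓ)`; split multiplicative; `c_ℓ(E_ét) = 3·c_ℓ(E_μ)`). -/
def tamPrimes : Finset ℕ := (badPrimes W).filter fun ℓ => vDisc W ℓ = 3 * vDisc W' ℓ

/-- KUMMER primes `S⁺`: `v_ℓ(Δ_μ) = 3·v_ℓ(Δ_ét)` and `ℓ ≡ 1 (mod 3)` (`P ∈ E⁰(ℚ_ℓ)`, split multiplicative,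
`c_ℓ(E_μ) = 3·c_ℓ(E_ét)`; among the primes with `P ∈ E⁰`, split ⟺ `ℓ ≡ 1 (mod 3)`). -/
def kumPrimes : Finset ℕ := (badPrimes W).filter fun ℓ => vDisc W' ℓ = 3 * vDisc W ℓ ∧ ℓ % 3 = 1

/-- The Kummer modulus `M = ∏_{ℓ ∈ S⁺} ℓ` (`= 1` when `S⁺ = ∅`). -/
def kumModulus : ℕ := ∏ ℓ ∈ kumPrimes W W', ℓ

/-- TAMAGAWA EXCESS `t := #Tam − #S⁺` (`= v₃(∏c(E_ét)) − v₃(∏c(E_μ))`; odd at analytic rank `0` by the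
root-number parity `#{split primes} ≡ 1 (mod 2)`; census values `−1, 1, 3`). -/
def tamExcess : ℤ := ((tamPrimes W W').card : ℤ) - (kumPrimes W W').card

/-- RÉDEI NONDEGENERACY (`s = 0`): no non-trivial cubic Dirichlet character modulo `M` is trivial on every
Tamagawa prime — equivalently the Rédei matrix `(χ_ℓ(ℓ₀))` has rank `#S⁺`, equivalently (class field
theory, K2) `Sel^{φ}(E_ét/ℚ) = 0`. Vacuously true when `S⁺ = ∅` (`M = 1`). -/
def RedeiNondegenerate : Prop :=
  ∀ χ : MulChar (ZMod (kumModulus W W')) ℂ, χ ^ 3 = 1 →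
    (∀ ℓ ∈ tamPrimes W W', χ (ℓ : ZMod (kumModulus W W')) = 1) → χ = 1

/-- RÉDEI DIMENSION `s := #S⁺ − rank_{𝔽₃} M = log₃ #{cubic χ mod M trivial on Tam}`
(`= dim_{𝔽₃} Sel^{φ}(E_ét/ℚ)`; census values `0, 1, 2`). -/
def redeiDim : ℕ :=
  Nat.log 3 (Nat.card {χ : MulChar (ZMod (kumModulus W W')) ℂ //
    χ ^ 3 = 1 ∧ ∀ ℓ ∈ tamPrimes W W', χ (ℓ : ZMod (kumModulus W W')) = 1})

end Data

/-! ## §1. The lever: the reciprocity law (CONJECTURE; census 3505/3505 twins + 137/137 in 9-chains) -/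

/-- **K1 (crux idea, rank 2) — CUBIC RÉDEI RECIPROCITY, first layer.** For a semistable rank-`0` X1 pair
`(E_ét, 3)` with its twin `E_μ`: Tamagawa excess `t = 1` and nondegenerate cubic Rédei matrix (`s = 0`)
⟹ `3 ∤ #Ш_an(E_ét)`, i.e. `v₃(L(E_ét,1)/Ω_ét) = v₃(∏_ℓ c_ℓ(E_ét)) − 2`. A CONSEQUENCE of `BSD(E_ét,3)`
(given K2), strictly weaker than the crux, and it implies the crux at every pair of the shallow stratum
(`mazurMainConjecture_of_cubicRedeiReciprocity`: 3505 of the 3890 semistable θ = 1 twin classes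
`N < 5·10⁵`). Why it might fail AS A LINE: the analytic engine — the level-`N` Eisenstein congruence of
`f_{E_ét}` modulo `𝔪²` / a tame Sharifi-type identification of Manin symbols with the cup products
`b_{ℓ₀} ∪ c_ℓ` whose local invariants are the `χ_ℓ(ℓ₀)` — is in print only at two-prime level
(Wake–Wang-Erickson 2021 Thm. 1.5.5, 1.7.1, Prop. 7.1.3), and `𝕋^ε_𝔪` alone does not see the Tam/S⁺
partition (census: 5 squarefree levels carry θ = 1 classes with equal Atkin–Lehner signs and different
depth), so the engine must be `f`-adapted (Berger–Klosin deformation ring of the NON-SPLIT residual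
representation `E_ét[3]`). -/
def CubicRedeiReciprocity : Prop :=
  ∀ (W W' : WeierstrassCurve ℚ) [W.IsElliptic] [W.IsGloballyMinimal] [W'.IsElliptic]
    [W'.IsGloballyMinimal],
    ClassX1 W 3 → W.analyticRank = 0 → Semistable W → IsThreeTwin W W' →
    tamExcess W W' = 1 → RedeiNondegenerate W W' →
    ∃ q : ℚ, shaAn W = (q : ℂ) ∧ padicValRat 3 q = 0

/-- **K1₀ — the LONELY sub-case (symbol-free):** exactly one Tamagawa prime and no Kummer prime
(`#Tam = 1`, `S⁺ = ∅`, so `t = 1`, `s = 0`) ⟹ `3 ∤ #Ш_an(E_ét)`, i.e. `v₃(L(E_ét,1)/Ω_ét) = v₃(c_{ℓ₀}) − 2`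
(`= −1` when `c_{ℓ₀} = 3`: the torsion point accounts for the whole `3`-denominator of `L(E,1)/Ω` and the
numerator is a `3`-unit). Census 1530/1530. -/
def CubicRedeiReciprocityLonely : Prop :=
  ∀ (W W' : WeierstrassCurve ℚ) [W.IsElliptic] [W.IsGloballyMinimal] [W'.IsElliptic]
    [W'.IsGloballyMinimal],
    ClassX1 W 3 → W.analyticRank = 0 → Semistable W → IsThreeTwin W W' →
    (tamPrimes W W').card = 1 → kumPrimes W W' = ∅ →
    ∃ q : ℚ, shaAn W = (q : ℂ) ∧ padicValRat 3 q = 0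

/-! ## §2. Support: the first `3`-isogeny descent in Rédei form (THEOREMS of the literature, to be proved) -/

/-- **K2 (support) — FIRST DESCENT, trivial case** (Cassels 1965 §§4–5 "Arithmetic on curves of genus 1,
VIII"; DeLong, Acta Arith. 2002; Cohen–Pazuki, Acta Arith. 2009; Schaefer–Stoll 2004): `(t,s) = (1,0)` ⟹
`Sel^{φ}(E_ét) = 0`, `Sel^{φ̂}(E_μ) = ⟨δP⟩`, hence `Sel³(E_ét) = ⟨δP⟩` and `Ш(E_ét/ℚ)[3] = 0` (local
conditions: unramified at `3` since `φ` is étale and `3 ∣ #Ẽ(𝔽₃)`; none at Kummer primes; "split" at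
Tamagawa primes; automatic at inert primes). Makes K1 a consequence of `BSD(E_ét,3)`. -/
def FirstDescentTrivial : Prop :=
  ∀ (W W' : WeierstrassCurve ℚ) [W.IsElliptic] [W.IsGloballyMinimal] [W'.IsElliptic]
    [W'.IsGloballyMinimal],
    W.HasGoodReductionAtPrime 3 → Semistable W → IsThreeTwin W W' →
    tamExcess W W' = 1 → RedeiNondegenerate W W' →
    ∀ x : W.sha, ((3 : ℕ) : ℤ) • x = 0 → x = 0

/-- **K3a (support) — FIRST DESCENT, deep étale case:** `t ≤ −1` or `s ≥ 1` ⟹ `Ш(E_ét/ℚ)[3] ≠ 0`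
(`Sel^{φ}(E_ét) ⊕ ⟨δP⟩ ↪ Sel³(E_ét)` has dimension `≥ 2 > rank + dim E(ℚ)[3] = 1` at analytic rank `0`;
when `t ≤ −1`, `s ≥ 1 − t ≥ 2` is forced by `dim Sel^{φ̂}(E_μ) = s + t ≥ 1`). -/
def FirstDescentDeepEtale : Prop :=
  ∀ (W W' : WeierstrassCurve ℚ) [W.IsElliptic] [W.IsGloballyMinimal] [W'.IsElliptic]
    [W'.IsGloballyMinimal],
    W.HasGoodReductionAtPrime 3 → Semistable W → IsThreeTwin W W' → W.analyticRank = 0 →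
    (tamExcess W W' ≤ -1 ∨ ¬ RedeiNondegenerate W W') →
    ∃ x : W.sha, x ≠ 0 ∧ (3 : ℕ) • x = 0

/-- **K3b (support) — FIRST DESCENT, deep μ case:** `t ≥ 3` ⟹ `dim_{𝔽₃} Ш(E_μ/ℚ)[3] ≥ s + t − 1 ≥ 2`
(Cassels' formula: `dim Sel^{φ̂}(E_μ) = s + t`; `E_μ(ℚ)/3 = 0` at analytic rank `0`). -/
def FirstDescentDeepMu : Prop :=
  ∀ (W W' : WeierstrassCurve ℚ) [W.IsElliptic] [W.IsGloballyMinimal] [W'.IsElliptic]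
    [W'.IsGloballyMinimal],
    W.HasGoodReductionAtPrime 3 → Semistable W → IsThreeTwin W W' → W.analyticRank = 0 →
    3 ≤ tamExcess W W' →
    ∃ x : W'.sha, x ≠ 0 ∧ (3 : ℕ) • x = 0

/-! ## §3. The empirical uniform first-layer law (CONJECTURAL REGULARITY; refutable) -/

/-- **K4 (candidate, rank 3) — ÉTALE FIRST-LAYER CAP:** `v₃(#Ш_an(E_ét)) ≤ 2s + t − 1`
(`= dim Sel^{φ}(E_ét) + dim Sel^{φ̂}(E_μ) − 1`, the first-descent bound for `dim_{𝔽₃} Sel³(E_ét) − 1`).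
Specialises to K1 at `(t,s) = (1,0)`; at `(t,s) ∈ {(−1,2),(1,1),(3,0)}` it is the cap `≤ 2` which, with
K3a and Cassels–Tate, DECIDES `BSD(E_ét,3)` (`bsdp_of_firstDescentDeepEtale_of_cap`). Census 3890/3890
(equality except in `(3,0)`: `v_ét = 0` ×234, `= 2` ×2). NOT implied by BSD (a twin with
`Ш(E_ét)[3^∞] ⊇ (ℤ/9)²` and tight first descent would violate it): the honest bet that the Rédei tower of
`E_ét` stops at layer one; cheapest refutation = one semistable θ = 1 twin with `81 ∣ #Ш_an(E_ét)`. -/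
def EtaleFirstLayerCap : Prop :=
  ∀ (W W' : WeierstrassCurve ℚ) [W.IsElliptic] [W.IsGloballyMinimal] [W'.IsElliptic]
    [W'.IsGloballyMinimal],
    ClassX1 W 3 → W.analyticRank = 0 → Semistable W → IsThreeTwin W W' →
    ∃ q : ℚ, shaAn W = (q : ℂ) ∧
      padicValRat 3 q ≤ 2 * (redeiDim W W' : ℤ) + tamExcess W W' - 1

/-! ## §4. Kernel-checked compositions -/

/-- **K1 ⟹ the crux's conclusion at every pair of the shallow stratum.** Granted the PUBLISHED named facts
Wuthrich 2014 Prop. 21 (`hW`) and Thm. 16 (`hW16`), Greenberg 1999 Thm. 4.1 (`hGr`), Gross–Zagier–Kolyvagin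
(`hGZK`), modularity (`hmod`): the reciprocity law gives `3 ∤ #Ш_an(E_ét)` and
`Rank1ResidualX1Converse.mazurMainConjecture_of_shaAn_unit` (Kato–Wuthrich + the converse chain) turns
that into `MazurMainConjecture E_ét 3`. No descent is needed in this direction. -/
theorem mazurMainConjecture_of_cubicRedeiReciprocity (hW : Wuthrich2014.sha_dvd_analyticSha)
    (hW16 : Wuthrich2014.charIdeal_dvd_padicLFunction) (hGr : greenberg_charValue_rankZero)
    (hGZK : rank_eq_analyticRank_of_analyticRank_le_one) (hmod : hasEntireLFunction_rat)
    (hR : CubicRedeiReciprocity)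
    (W W' : WeierstrassCurve ℚ) [W.IsElliptic] [W.IsGloballyMinimal] [W'.IsElliptic]
    [W'.IsGloballyMinimal]
    (hX1 : ClassX1 W 3) (hr0 : W.analyticRank = 0) (hss : Semistable W) (htw : IsThreeTwin W W')
    (ht : tamExcess W W' = 1) (hs : RedeiNondegenerate W W') : MazurMainConjecture W 3 := by
  have hL : W.entireLFunction 1 ≠ 0 := (W.analyticRank_eq_zero_iff_holds (hmod W)).mp hr0
  exact mazurMainConjecture_of_shaAn_unit hW hW16 hGr hGZK W 3 hX1 hL (hR W W' hX1 hr0 hss htw ht hs)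

/-- **K1 + K2 ⟹ Miller's `BSD(E_ét,3)` on the shallow stratum with NO Iwasawa theory** (GZK only): the
tree's shallow door `X1.bsdp_of_noPTorsion` takes `3 ∤ #Ш_an` (K1) and `Ш[3] = 0` (K2). -/
theorem bsdp_of_cubicRedeiReciprocity_of_firstDescentTrivial
    (hGZK : rank_eq_analyticRank_of_analyticRank_le_one)
    (hR : CubicRedeiReciprocity) (hD : FirstDescentTrivial)
    (W W' : WeierstrassCurve ℚ) [W.IsElliptic] [W.IsGloballyMinimal] [W'.IsElliptic]
    [W'.IsGloballyMinimal]
    (hX1 : ClassX1 W 3) (hr0 : W.analyticRank = 0) (hss : Semistable W) (htw : IsThreeTwin W W')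
    (ht : tamExcess W W' = 1) (hs : RedeiNondegenerate W W') : BSDp W 3 := by
  obtain ⟨q, hq, hv⟩ := hR W W' hX1 hr0 hss htw ht hs
  have hgood : W.HasGoodReductionAtPrime 3 := (isClassX1_of_classX1 hX1).hasGoodReductionAtPrime
  exact X1.bsdp_of_noPTorsion hGZK W 3 (by omega) hX1 hq hv (hD W W' hgood hss htw ht hs)

/-- **K3a + a depth-2 cap ⟹ `BSD(E_ét,3)` on the deep étale strata** through the cell's first-descent door
`X1.bsdp_of_casselsTate_of_exists_torsion` (Kato–Wuthrich `#Ш ∣ #Ш_an` + Cassels–Tate squareness).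
The cap `ord₃ #Ш_an(E_ét) ≤ 2` is K4 at `(t,s) ∈ {(−1,2),(1,1),(3,0)}` — 383 of the 385 deep twins; at the
two `(3,0,2,4)` twins `58646f`, `376402f` it holds too (`v_ét = 2`), so there `BSD(E,3)` follows from K3a's
conclusion on `E_ét`, which a FULL `3`-descent on `E_ét` (predicted `dim Sel³(E_ét) = 3`) certifies per
curve: those two residue classes need no second descent. -/
theorem bsdp_of_firstDescentDeepEtale_of_cap (hCT : exists_casselsTate_pairing (K := ℚ))
    (hW : Wuthrich2014.sha_dvd_analyticSha) (hGZK : rank_eq_analyticRank_of_analyticRank_le_one)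
    (hmod : hasEntireLFunction_rat) (hD : FirstDescentDeepEtale)
    (W W' : WeierstrassCurve ℚ) [W.IsElliptic] [W.IsGloballyMinimal] [W'.IsElliptic]
    [W'.IsGloballyMinimal]
    (hX1 : ClassX1 W 3) (hr0 : W.analyticRank = 0) (hss : Semistable W) (htw : IsThreeTwin W W')
    (hdeep : tamExcess W W' ≤ -1 ∨ ¬ RedeiNondegenerate W W')
    {q : ℚ} (hq : shaAn W = (q : ℂ)) (hcap : padicValRat 3 q ≤ 2) : BSDp W 3 :=
  have hgood : W.HasGoodReductionAtPrime 3 := (isClassX1_of_classX1 hX1).hasGoodReductionAtPrime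
  X1.bsdp_of_casselsTate_of_exists_torsion hCT hW hGZK hmod W 3 (by omega) hX1 hr0 hq hcap
    (hD W W' hgood hss htw hr0 hdeep)

/-- The SHALLOW RÉDEI STRATUM of a pair `(W, p)`: `p = 3`, `W` semistable with a θ = 1 twin `W'` for which
`t = 1` and `s = 0` (decidable from the two minimal models). -/
def ShallowRedeiStratum (W : WeierstrassCurve ℚ) [W.IsGloballyMinimal] (p : ℕ) : Prop :=
  p = 3 ∧ Semistable W ∧ ∃ (W' : WeierstrassCurve ℚ) (_ : W'.IsElliptic) (_ : W'.IsGloballyMinimal),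
    IsThreeTwin W W' ∧ tamExcess W W' = 1 ∧ RedeiNondegenerate W W'

/-- **K1 + (the crux OFF the shallow Rédei stratum) ⟹ the crux BY NAME** — what the reciprocity law
removes from the burden of `stub_deepWitness` (line `deepwitness`). Pure logic over
`mazurMainConjecture_of_cubicRedeiReciprocity`. -/
theorem mazurMCOnX1RankZero_of_cubicRedeiReciprocity_of_offStratum
    (hW : Wuthrich2014.sha_dvd_analyticSha)
    (hW16 : Wuthrich2014.charIdeal_dvd_padicLFunction) (hGr : greenberg_charValue_rankZero)
    (hGZK : rank_eq_analyticRank_of_analyticRank_le_one) (hmod : hasEntireLFunction_rat)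
    (hR : CubicRedeiReciprocity)
    (hOff : ∀ (W : WeierstrassCurve ℚ) [W.IsElliptic] [W.IsGloballyMinimal] (p : ℕ) [Fact p.Prime],
      ClassX1 W p → W.analyticRank = 0 → ¬ ShallowRedeiStratum W p → MazurMainConjecture W p) :
    Summit.BirchSwinnertonDyer.BirchSwinnertonDyer.Theses.EisensteinPrimes.MazurMCOnX1RankZero := by
  intro W _ _ p _ hX1 hr0
  by_cases hS : ShallowRedeiStratum W p
  · obtain ⟨rfl, hss, W', _, _, htw, ht, hs⟩ := hS
    have h3 : MazurMainConjecture W 3 :=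
      mazurMainConjecture_of_cubicRedeiReciprocity hW hW16 hGr hGZK hmod hR W W'
        (by convert hX1) hr0 hss htw ht hs
    convert h3
  · exact hOff W p hX1 hr0 hS

/-- K1 ⟹ K1₀ (the lonely case has `t = 1` and, `M` being `1`, a nondegenerate — empty — Rédei matrix). -/
theorem cubicRedeiReciprocityLonely_of (hR : CubicRedeiReciprocity) : CubicRedeiReciprocityLonely := by
  intro W W' _ _ _ _ hX1 hr0 hss htw hT hK
  refine hR W W' hX1 hr0 hss htw ?_ ?_
  · simp [tamExcess, hT, hK]
  · intro χ _ _
    have hM : kumModulus W W' = 1 := by simp [kumModulus, hK]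
    haveI : Subsingleton (ZMod (kumModulus W W')) := ZMod.subsingleton_iff.2 hM
    apply MulChar.ext
    intro u
    rw [MulChar.one_apply_coe, Subsingleton.elim (u : ZMod (kumModulus W W')) 1, map_one]

end Summit.BirchSwinnertonDyer.BirchSwinnertonDyer.Cruxes.MazurMCOnX1RankZero.CubicRedei
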